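import Summits.AtomisticToContinuum.BoseEinsteinCondensation.Theorems.BECCutLineWeakDisorderTwoReplicaTransienceBoundInsertionStep
import Literature.Probability.Process.BrownianIncrementSup
import HarnessLib

/-!
# Crux `TwoReplicaTransienceBound` (stmt-AtomisticToContinuum-9687), line `SketchIdeator1` v7:
# the TIME-SLICED sausage domination (stub `stub_slicedDomination`)

Support file (`--supports stmt-AtomisticToContinuum-9687`, lead c4). The sliced analogue of
`Insertion.one_le_expNeg_add_sum_sausage` (…InsertionStep.lean). For a pair potential `v` of finite range `R`
(`v r = 0` for `r > R`), a slice length `h > 0`, `M ≥ 1` slices and a time horizon `t ≤ M h`: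

`1 ≤ e^{-(tagged–bath action up to t)}
   + Σⱼ Σ_{k<M} 𝟙{Yⱼ ∈ B(x + √2 b_{kh}(ω₀) - √2 b_{kh}(ωbⱼ), R + √2 (S_k(ω₀) + S_k(ωbⱼ)))}`,

where `S_k(ω) = Σ_c incRunSup (kh) h (ω c)` is the sum of the three coordinate running suprema of the Brownian
INCREMENTS on the slice `[kh, kh + h]` (`Literature.Probability.Process.incRunSup`). Indeed, if no indicator
fires then at every time `s ∈ (0, t]` — which lies in some slice `[kh, kh + h]`, `k < M`
(`SlicedDomination.exists_slice`) — the tagged line `x + √2 b_s(ω₀) = (x + √2 b_{kh}(ω₀)) + Δ₀` and the bath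
line `Yⱼ + √2 b_s(ωbⱼ) = (Yⱼ + √2 b_{kh}(ωbⱼ)) + Δⱼ` have moved by at most `‖Δ‖ ≤ √2 S_k` from their
slice-start positions (`SlicedDomination.norm_toLp_brownian_sub_le`, from `abs_incr_le_incRunSup`), so they are
more than `R` apart (`Insertion.dist_add_add_ge`) and `v = 0` there: the action integrand vanishes on `(0, t]`
(`SlicedDomination.taggedBathAction_eq_zero_of_far_sliced`) and `e^{-0} = 1`. Otherwise some indicator is `1`
and the double sum is `≥ 1` (`SlicedDomination.one_le_expNeg_add_sum_sum_indicator`).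

The point of slicing (used downstream, not here): the one-ball reach of the unsliced bound has volume `∼ t^{3/2}`,
while the `M` slice balls have total expected volume linear in `t` (Wiener sausage / Spitzer).
-/

noncomputable section

open MeasureTheory Filter Set
open scoped ENNReal NNReal Topology BigOperators

namespace Summit.AtomisticToContinuum.BoseEinsteinCondensation.Cruxes.TwoReplicaTransienceBound.TracerDecoupling

open Literature.MathematicalPhysics.QuantumManyBody.BoseGas
open Literature.Probability.Process (brownian incRunSup incRunSup_nonneg abs_incr_le_incRunSup)
open TracerFactorisation

namespace SlicedDomination

variable {m : ℕ}

/-! ### Time bookkeeping: every time in `[0, M h]` lies in a slice `[k h, k h + h]` with `k < M` -/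

/-- Real version of the slice selection: for `h > 0`, `M ≥ 1` and `0 ≤ s ≤ M h` there is `k < M` with
`k h ≤ s ≤ k h + h` (take `k = min ⌊s/h⌋₊ (M - 1)`). -/
theorem exists_slice_real {h : ℝ} (hh : 0 < h) {M : ℕ} (hM : 1 ≤ M) {s : ℝ} (hs0 : 0 ≤ s)
    (hs : s ≤ (M : ℝ) * h) : ∃ k < M, (k : ℝ) * h ≤ s ∧ s ≤ (k : ℝ) * h + h := by
  have hfl : (⌊s / h⌋₊ : ℝ) * h ≤ s := by
    have := Nat.floor_le (div_nonneg hs0 hh.le)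
    rwa [le_div_iff₀ hh] at this
  by_cases hlt : ⌊s / h⌋₊ < M
  · refine ⟨⌊s / h⌋₊, hlt, hfl, ?_⟩
    have := Nat.lt_floor_add_one (s / h)
    rw [div_lt_iff₀ hh] at this
    linarith
  · push Not at hlt
    have hM' : (M : ℝ) ≤ ⌊s / h⌋₊ := by exact_mod_cast hlt
    have hc : ((M - 1 : ℕ) : ℝ) = M - 1 := by rw [Nat.cast_sub hM, Nat.cast_one]
    have hMh : (M : ℝ) * h ≤ ⌊s / h⌋₊ * h := mul_le_mul_of_nonneg_right hM' hh.le
    refine ⟨M - 1, Nat.sub_lt hM one_pos, ?_, ?_⟩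
    · rw [hc]; linarith
    · rw [hc]; linarith

/-- Slice selection in `ℝ≥0`: for `h > 0`, `M ≥ 1` and `s ≤ M h` there is a slice `k < M` with
`k h ≤ s ≤ k h + h`. -/
theorem exists_slice {h : ℝ≥0} (hh : 0 < h) {M : ℕ} (hM : 1 ≤ M) {s : ℝ≥0} (hs : s ≤ (M : ℝ≥0) * h) :
    ∃ k < M, (k : ℝ≥0) * h ≤ s ∧ s ≤ (k : ℝ≥0) * h + h := by
  have hh' : (0 : ℝ) < h := by exact_mod_cast hh
  have hs' : (s : ℝ) ≤ (M : ℝ) * h := by exact_mod_cast hs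
  obtain ⟨k, hk, h1, h2⟩ := exists_slice_real hh' hM s.coe_nonneg hs'
  exact ⟨k, hk, by exact_mod_cast h1, by exact_mod_cast h2⟩

/-! ### Displacement within a slice -/

/-- **The displacement of a world-line over `[u, s] ⊆ [u, u + h]` is at most `√2 ×` the sum of its three
coordinate increment running suprema on the slice**: `‖√2 b_s - √2 b_u‖ ≤ √2 Σ_c incRunSup u h (ω c)` for
`u ≤ s ≤ u + h` (coordinatewise `|b_s - b_u| ≤ incRunSup u h`, `abs_incr_le_incRunSup`, and `‖·‖₂ ≤ ‖·‖₁`). -/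
theorem norm_toLp_brownian_sub_le (ω : Fin 3 → (ℝ≥0 → ℝ)) {u h s : ℝ≥0} (hus : u ≤ s) (hsh : s ≤ u + h) :
    ‖WithLp.toLp 2 (fun c : Fin 3 => Real.sqrt 2 * brownian s (ω c)) -
        WithLp.toLp 2 (fun c : Fin 3 => Real.sqrt 2 * brownian u (ω c))‖ ≤
      Real.sqrt 2 * ∑ c, incRunSup u h (ω c) := by
  obtain ⟨v, rfl⟩ : ∃ v, s = u + v := ⟨s - u, (add_tsub_cancel_of_le hus).symm⟩
  have hv : v ≤ h := le_of_add_le_add_left hsh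
  have h2 : 0 ≤ Real.sqrt 2 := Real.sqrt_nonneg 2
  have hsq2 : Real.sqrt 2 ^ 2 = 2 := Real.sq_sqrt (by norm_num)
  have hb : ∀ c, |brownian (u + v) (ω c) - brownian u (ω c)| ≤ incRunSup u h (ω c) :=
    fun c => abs_incr_le_incRunSup hv (ω c)
  have hM : ∀ c, 0 ≤ incRunSup u h (ω c) := fun c => incRunSup_nonneg u h (ω c)
  have hS : 0 ≤ Real.sqrt 2 * ∑ c, incRunSup u h (ω c) := mul_nonneg h2 (Finset.sum_nonneg fun c _ => hM c)
  have hΔ : WithLp.toLp 2 (fun c : Fin 3 => Real.sqrt 2 * brownian (u + v) (ω c)) -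
      WithLp.toLp 2 (fun c : Fin 3 => Real.sqrt 2 * brownian u (ω c)) =
        WithLp.toLp 2 (fun c : Fin 3 => Real.sqrt 2 * (brownian (u + v) (ω c) - brownian u (ω c))) := by
    rw [← WithLp.toLp_sub]
    congr 1
    funext c
    simp only [Pi.sub_apply, mul_sub]
  rw [hΔ, EuclideanSpace.norm_eq, Real.sqrt_le_left hS]
  simp only [Real.norm_eq_abs, Fin.sum_univ_three, abs_mul, abs_of_nonneg h2]
  have h0 := hb 0; have h1 := hb 1; have h2' := hb 2
  have m0 := hM 0; have m1 := hM 1; have m2 := hM 2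
  have a0 := abs_nonneg (brownian (u + v) (ω 0) - brownian u (ω 0))
  have a1 := abs_nonneg (brownian (u + v) (ω 1) - brownian u (ω 1))
  have a2 := abs_nonneg (brownian (u + v) (ω 2) - brownian u (ω 2))
  nlinarith [mul_le_mul h0 h0 a0 m0, mul_le_mul h1 h1 a1 m1, mul_le_mul h2' h2' a2 m2,
    mul_nonneg m0 m1, mul_nonneg m0 m2, mul_nonneg m1 m2]

/-! ### Finite range, sliced: no slice ball hit ⇒ no action -/

/-- **Finite range, sliced: if no slice ball contains the start of a bath line, the tagged–bath action
vanishes.** If for every bath line `j` and every slice `k < M`,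
`dist (x + √2 b_{kh}(ω₀) - √2 b_{kh}(ωbⱼ)) Yⱼ > R + √2 (S_k(ω₀) + S_k(ωbⱼ))`, then at every time
`s ∈ (0, t]`, `t ≤ M h` (so `s` lies in a slice `k < M`, `exists_slice`), the tagged line from `x` and line
`j` from `Yⱼ` are more than `R` apart (`norm_toLp_brownian_sub_le`, `Insertion.dist_add_add_ge`), so
`v = 0` there and `∫₀ᵗ Σⱼ v = 0`. -/
theorem taggedBathAction_eq_zero_of_far_sliced {v : ℝ → ℝ≥0∞} {R : ℝ} (hR : ∀ r, R < r → v r = 0)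
    {h : ℝ≥0} (hh : 0 < h) {M : ℕ} (hM : 1 ≤ M) {t : ℝ} (ht : t ≤ (M : ℝ) * h) (x : Space) (Y : Config m)
    (ω₀ : Fin 3 → (ℝ≥0 → ℝ)) (ωb : PathSpace m)
    (hfar : ∀ j, ∀ k < M, R + Real.sqrt 2 * ((∑ c, incRunSup ((k : ℝ≥0) * h) h (ω₀ c)) +
        ∑ c, incRunSup ((k : ℝ≥0) * h) h (ωb j c)) <
      dist (x + WithLp.toLp 2 (fun c : Fin 3 => Real.sqrt 2 * brownian ((k : ℝ≥0) * h) (ω₀ c)) -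
        WithLp.toLp 2 (fun c : Fin 3 => Real.sqrt 2 * brownian ((k : ℝ≥0) * h) (ωb j c))) (Y j)) :
    taggedBathAction v t x Y ω₀ ωb = 0 := by
  unfold taggedBathAction
  refine setLIntegral_eq_zero measurableSet_Ioc fun s hs => ?_
  simp only [Pi.zero_apply]
  refine Finset.sum_eq_zero fun j _ => hR _ ?_
  -- the slice `k < M` containing `s`
  have hsM : s.toNNReal ≤ (M : ℝ≥0) * h := by
    rw [Real.toNNReal_le_iff_le_coe]
    push_cast
    exact hs.2.trans ht
  obtain ⟨k, hkM, hks, hsk⟩ := exists_slice hh hM hsM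
  have hf := hfar j k hkM
  rw [mul_add] at hf
  rw [worldLine_vecCons_cons_zero, worldLine_vecCons_cons_succ]
  have hj : worldLine Y ωb s.toNNReal j =
      Y j + WithLp.toLp 2 (fun c : Fin 3 => Real.sqrt 2 * brownian s.toNNReal (ωb j c)) := rfl
  rw [hj]
  -- slice-start displacements `a₀, aj` and the increments `p₀ - a₀`, `pj - aj`
  have ha := norm_toLp_brownian_sub_le ω₀ hks hsk
  have hb := norm_toLp_brownian_sub_le (ωb j) hks hsk
  have hd := Insertion.dist_add_add_ge
    (x + WithLp.toLp 2 (fun c : Fin 3 => Real.sqrt 2 * brownian ((k : ℝ≥0) * h) (ω₀ c)))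
    (Y j + WithLp.toLp 2 (fun c : Fin 3 => Real.sqrt 2 * brownian ((k : ℝ≥0) * h) (ωb j c)))
    (WithLp.toLp 2 (fun c : Fin 3 => Real.sqrt 2 * brownian s.toNNReal (ω₀ c)) -
      WithLp.toLp 2 (fun c : Fin 3 => Real.sqrt 2 * brownian ((k : ℝ≥0) * h) (ω₀ c)))
    (WithLp.toLp 2 (fun c : Fin 3 => Real.sqrt 2 * brownian s.toNNReal (ωb j c)) -
      WithLp.toLp 2 (fun c : Fin 3 => Real.sqrt 2 * brownian ((k : ℝ≥0) * h) (ωb j c)))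
  have he : dist (x + WithLp.toLp 2 (fun c : Fin 3 => Real.sqrt 2 * brownian ((k : ℝ≥0) * h) (ω₀ c)))
      (Y j + WithLp.toLp 2 (fun c : Fin 3 => Real.sqrt 2 * brownian ((k : ℝ≥0) * h) (ωb j c))) =
      dist (x + WithLp.toLp 2 (fun c : Fin 3 => Real.sqrt 2 * brownian ((k : ℝ≥0) * h) (ω₀ c)) -
        WithLp.toLp 2 (fun c : Fin 3 => Real.sqrt 2 * brownian ((k : ℝ≥0) * h) (ωb j c))) (Y j) := by
    simp only [dist_eq_norm]
    congr 1
    abel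
  have h1 : x + WithLp.toLp 2 (fun c : Fin 3 => Real.sqrt 2 * brownian ((k : ℝ≥0) * h) (ω₀ c)) +
      (WithLp.toLp 2 (fun c : Fin 3 => Real.sqrt 2 * brownian s.toNNReal (ω₀ c)) -
        WithLp.toLp 2 (fun c : Fin 3 => Real.sqrt 2 * brownian ((k : ℝ≥0) * h) (ω₀ c))) =
      x + WithLp.toLp 2 (fun c : Fin 3 => Real.sqrt 2 * brownian s.toNNReal (ω₀ c)) := by abel
  have h2 : Y j + WithLp.toLp 2 (fun c : Fin 3 => Real.sqrt 2 * brownian ((k : ℝ≥0) * h) (ωb j c)) +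
      (WithLp.toLp 2 (fun c : Fin 3 => Real.sqrt 2 * brownian s.toNNReal (ωb j c)) -
        WithLp.toLp 2 (fun c : Fin 3 => Real.sqrt 2 * brownian ((k : ℝ≥0) * h) (ωb j c))) =
      Y j + WithLp.toLp 2 (fun c : Fin 3 => Real.sqrt 2 * brownian s.toNNReal (ωb j c)) := by abel
  rw [h1, h2, he] at hd
  linarith

/-! ### The domination pattern -/

/-- **Domination pattern**: if the action `A` vanishes whenever none of the sets `B j k`, `k < M`, contains
`y j`, then `1 ≤ e^{-A} + Σⱼ Σ_{k<M} 𝟙_{B j k}(y j)` (either some indicator is `1`, or `e^{-0} = 1`). -/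
theorem one_le_expNeg_add_sum_sum_indicator {ι : Type*} [Fintype ι] {α : Type*} (M : ℕ) (A : ℝ≥0∞)
    (B : ι → ℕ → Set α) (y : ι → α) (hA : (∀ j, ∀ k < M, y j ∉ B j k) → A = 0) :
    1 ≤ expNeg A + ∑ j, ∑ k ∈ Finset.range M, (B j k).indicator (fun _ => (1 : ℝ≥0∞)) (y j) := by
  by_cases hex : ∃ j, ∃ k < M, y j ∈ B j k
  · obtain ⟨j, k, hk, hjk⟩ := hex
    calc (1 : ℝ≥0∞) = (B j k).indicator (fun _ => (1 : ℝ≥0∞)) (y j) :=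
        (Set.indicator_of_mem hjk fun _ => (1 : ℝ≥0∞)).symm
      _ ≤ ∑ k ∈ Finset.range M, (B j k).indicator (fun _ => (1 : ℝ≥0∞)) (y j) :=
        Finset.single_le_sum (f := fun k => (B j k).indicator (fun _ => (1 : ℝ≥0∞)) (y j))
          (fun _ _ => bot_le) (Finset.mem_range.2 hk)
      _ ≤ ∑ j, ∑ k ∈ Finset.range M, (B j k).indicator (fun _ => (1 : ℝ≥0∞)) (y j) :=
        Finset.single_le_sum (f := fun j => ∑ k ∈ Finset.range M, (B j k).indicator (fun _ => (1 : ℝ≥0∞)) (y j))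
          (fun _ _ => bot_le) (Finset.mem_univ j)
      _ ≤ _ := le_add_self
  · push Not at hex
    rw [hA hex, expNeg_zero]
    exact le_self_add

end SlicedDomination

open SlicedDomination in
/-- **The time-sliced sausage penalty dominates the tagged–bath Boltzmann factor** (registered stub
`stub_slicedDomination` of the line `SketchIdeator1`, skeleton v7): for `v` of finite range `R`, slice length
`h > 0`, `M ≥ 1` slices and `t ≤ M h`,
`1 ≤ e^{-(tagged–bath action up to t)} + Σⱼ Σ_{k<M} 𝟙{Yⱼ ∈ B(x + √2 b_{kh}(ω₀) - √2 b_{kh}(ωbⱼ), R + √2(S_k(ω₀) + S_k(ωbⱼ)))}`,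
`S_k(ω) = Σ_c incRunSup (kh) h (ω c)`: either some slice ball is hit, or the action vanishes
(`SlicedDomination.taggedBathAction_eq_zero_of_far_sliced`). -/
theorem stub_slicedDomination :
    ∀ (m : ℕ) (v : ℝ → ℝ≥0∞) (R : ℝ), (∀ r, R < r → v r = 0) → ∀ (h : ℝ≥0), 0 < h → ∀ (M : ℕ), 1 ≤ M →
      ∀ (t : ℝ), t ≤ (M : ℝ) * h → ∀ (x : Space) (Y : Config m) (ω₀ : Fin 3 → (ℝ≥0 → ℝ)) (ωb : PathSpace m),
        1 ≤ expNeg (taggedBathAction v t x Y ω₀ ωb) +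
          ∑ j, ∑ k ∈ Finset.range M,
            (Metric.closedBall
              (x + WithLp.toLp 2 (fun c : Fin 3 => Real.sqrt 2 * brownian ((k : ℝ≥0) * h) (ω₀ c)) -
                WithLp.toLp 2 (fun c : Fin 3 => Real.sqrt 2 * brownian ((k : ℝ≥0) * h) (ωb j c)))
              (R + Real.sqrt 2 * ((∑ c, incRunSup ((k : ℝ≥0) * h) h (ω₀ c)) +
                ∑ c, incRunSup ((k : ℝ≥0) * h) h (ωb j c)))).indicator (fun _ => (1 : ℝ≥0∞)) (Y j) := by
  intro m v R hR h hh M hM t ht x Y ω₀ ωb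
  refine one_le_expNeg_add_sum_sum_indicator M (taggedBathAction v t x Y ω₀ ωb)
    (fun j k => Metric.closedBall
      (x + WithLp.toLp 2 (fun c : Fin 3 => Real.sqrt 2 * brownian ((k : ℝ≥0) * h) (ω₀ c)) -
        WithLp.toLp 2 (fun c : Fin 3 => Real.sqrt 2 * brownian ((k : ℝ≥0) * h) (ωb j c)))
      (R + Real.sqrt 2 * ((∑ c, incRunSup ((k : ℝ≥0) * h) h (ω₀ c)) +
        ∑ c, incRunSup ((k : ℝ≥0) * h) h (ωb j c)))) Y fun hfar' => ?_
  refine taggedBathAction_eq_zero_of_far_sliced hR hh hM ht x Y ω₀ ωb fun j k hk => ?_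
  have hjk := hfar' j k hk
  rw [Metric.mem_closedBall, not_le, dist_comm] at hjk
  exact hjk

end Summit.AtomisticToContinuum.BoseEinsteinCondensation.Cruxes.TwoReplicaTransienceBound.TracerDecoupling

end
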